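import Summits.BirchSwinnertonDyer.BirchSwinnertonDyer.Theorems.KatoDescentPotSupersingularWildFineSelmerFineUnitAnchor
import Summits.BirchSwinnertonDyer.Rank1Residual.Iwasawa.LocalTowerKernelCardLeTamagawa
import Literature.NumberTheory.EllipticCurves.TamagawaSubgroupProofs
import HarnessLib

/-!
# The FINE UNIT-ANCHOR road with the TAMAGAWA socket away from `p`: (A) at `(E′, p)` and Upper at a
# congruent ♯ row from `rank 0`, `Ш[p] = 0`, `p ∤ ∏ c_ℓ(E′)` and ONE local test at `p`
# (`E′(ℚ_p)[p] = 0` — a ROW property) — anchors of ANY reduction type at `p`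
# (route `KatoDescentPotSupersingular`, rung K9, cell `bsd-potss`; crux item stmt-BirchSwinnertonDyer-19386;
# a `--supports … --as helper` file; seat `bsd-potss-k9-c4` g6; ROUTE-FREE; nothing booked, BSD is not
# proved by any of this)

WHY. The fine control theorem (`FineSelmerControl.fineSelmerInfty_eq_bot_of_natCard_selmerGroupPInfty_eq_one_of_local`,
p479853) has two local sockets at a place `v ∤ p`: the torsion socket (`E′(K_v)[p] = 0`) or the classical
level-`0` local tower kernel `𝒦_{v,0}[p^∞] = 0`. The tree already bounds the latter by the Tamagawa number
for EVERY reduction type (`Rank1Residual/Iwasawa/LocalTowerKernelCardLeTamagawa`: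
`#𝒦_{v,0}[p^∞] ≤ p^{ord_p c_v}`, Greenberg's Lemma 3.3 / `ker r_v` has order `c_v^{(p)}`), so `p ∤ c_v` discharges
it, and `p ∤ ∏_ℓ c_ℓ` discharges ALL places `v ∤ p` at once. The certificate of the fine unit-anchor road then
reads like the older unit-anchor roads, with the reduction hypothesis at `p` REPLACED by the single local
torsion test at `p`:

  `rank E′(ℚ) = 0`, `#Ш(E′)[p^∞] = 1`, `p ∤ ∏ c_ℓ(E′)`, and `E′[p^∞]` has no non-zero `D_p`-fixed `p`-torsion.

* §1 `localTowerKerPrimary_zero_eq_bot_of_not_dvd_localTamagawaNumber`, `…_of_not_dvd_tamagawaProduct`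
  (any number field; `c_v ∣ ∏ c`).
* §2 `conjA_of_fineUnitData_tamagawa` (any `K`), `conjA_rat_of_fineUnitData_tamagawa`.
* §3 row road **`missingUpperBoundAt_wild_of_fineUnitAnchor_tamagawa`** (+ `_analytic`) and the class form
  `wildFineSelmerCoatesSujatha_of_fineTamagawaAnchorCertificates`.

HONEST FRAMING: unconditional kernel plumbing on the anchor side; conditional-results on the ROW side's named
facts (`hLS`, `hKatoA`, GZK, modularity — all typed in the tree); per-row data are hypotheses (census data of
record); items 19386/19197 NOT closed; class-wide (A) is a named open problem. References: [GreenbergLNM1716]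
Prop. 3.8 (pp. 95–96), §3 Lemma 3.3 and the paragraph after it (pp. 86–88); [CoatesSujatha2005] §3;
[LimSujatha2018] §3 Prop. 3.2; [SilvermanAEC2009] VII.6.
-/

set_option autoImplicit false
-- sibling precedent (`KatoDescentPotSupersingularAssembly.lean`): the directory name repeats the summit name
set_option linter.dupNamespace false

noncomputable section

open scoped Classical

universe u

namespace Summit.BirchSwinnertonDyer.BirchSwinnertonDyer.Theorems.WildFineSelmerFineUnitAnchorTamagawa

open NumberField IsDedekindDomain Field
open WeierstrassCurve Literature.NumberTheory.EllipticCurves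
  Literature.NumberTheory.EllipticCurves.GreenbergSelmer
  Literature.NumberTheory.EllipticCurves.IwasawaAlgebra
  Literature.NumberTheory.EllipticCurves.Rank1Residual
  Literature.NumberTheory.EllipticCurves.Rank1Residual.Typed
  Literature.NumberTheory.EllipticCurves.ZpExtension
  Summit.BirchSwinnertonDyer.Rank1Residual Summit.BirchSwinnertonDyer.Rank1Residual.Additive
  Summit.BirchSwinnertonDyer.Rank1Residual.O6 Summit.BirchSwinnertonDyer.Rank1Residual.Iwasawa
  Summit.BirchSwinnertonDyer.BirchSwinnertonDyer.Theorems

/-! ## §1 The classical socket at `v ∤ p` from `p ∤ c_v` -/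

section AnyField

variable {K : Type u} [Field K] [NumberField K] (W : WeierstrassCurve K) [W.IsElliptic] {p : ℕ}
  [Fact p.Prime] (κ : ZpExtension K p)

/-- **`p ∤ c_v ⟹ 𝒦_{v,0}[p^∞] = 0`** at a finite place `v ∤ p` (any reduction type, any `ℤ_p`-extension): the
tree's bound `#𝒦_{v,0}[p^∞] ≤ p^{ord_p c_v}` (`finite_and_natCard_localTowerKerPrimary_zero_le_pow_padicValNat_localTamagawaNumber`)
with exponent `0`. [cite: GreenbergLNM1716, §3 Lemma 3.3 and the paragraph following its proof (pp. 86–88)] -/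
theorem localTowerKerPrimary_zero_eq_bot_of_not_dvd_localTamagawaNumber {v : HeightOneSpectrum (𝓞 K)}
    (hpv : ((p : ℕ) : 𝓞 K) ∉ v.asIdeal)
    (hc : ¬ p ∣ (W.baseChange (v.adicCompletion K)).localTamagawaNumber (v.adicCompletionIntegers K)) :
    W.localTowerKerPrimary κ (v.adicCompletion K) 0 = ⊥ := by
  obtain ⟨hfin, hcard⟩ :=
    finite_and_natCard_localTowerKerPrimary_zero_le_pow_padicValNat_localTamagawaNumber W κ hpv
  haveI := hfin
  rw [padicValNat.eq_zero_of_not_dvd hc, pow_zero] at hcard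
  haveI : Subsingleton (W.localTowerKerPrimary κ (v.adicCompletion K) 0) :=
    Finite.card_le_one_iff_subsingleton.mp hcard
  exact (W.localTowerKerPrimary κ (v.adicCompletion K) 0).eq_bot_of_subsingleton

/-- **`p ∤ ∏_ℓ c_ℓ ⟹ 𝒦_{v,0}[p^∞] = 0` at every `v ∤ p`** (`c_v` divides the Tamagawa product, a finite
product over the bad places). [cite: GreenbergLNM1716, §3 Lemma 3.3 (pp. 86–88)] [cite: SilvermanAEC2009, Cor. VII.6.2] -/
theorem localTowerKerPrimary_zero_eq_bot_of_not_dvd_tamagawaProduct {v : HeightOneSpectrum (𝓞 K)}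
    (hpv : ((p : ℕ) : 𝓞 K) ∉ v.asIdeal) (htam : ¬ p ∣ W.tamagawaProduct) :
    W.localTowerKerPrimary κ (v.adicCompletion K) 0 = ⊥ := by
  refine localTowerKerPrimary_zero_eq_bot_of_not_dvd_localTamagawaNumber W κ hpv fun hc ↦ htam ?_
  exact hc.trans (finprod_mem_dvd v W.mulSupport_localTamagawaNumber_finite_holds)

/-! ## §2 (A) at `(E′, p)` from `rank 0`, `Ш[p] = 0`, `p ∤ ∏ c` and the local test at `p` -/

/-- **(A) at `(E, p)` over ANY `ℤ_p`-extension from the Tamagawa form of the fine unit data** (number field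
`K`): `rank E(K) = 0`, `#Ш(E/K)[p^∞] = 1`, `p ∤ ∏_v c_v`, and no non-zero `D_v`-fixed `p`-torsion of `E[p^∞]` at
the places `v ∣ p` of a finite set `S` off which `E` is good and `v ∤ p`. Then `Sel₀(K_∞, E[p^∞]) = 0`, so its
dual is finitely generated over `ℤ_p`. No reduction hypothesis anywhere.
[cite: GreenbergLNM1716, Prop. 3.8 (pp. 95–96)] [cite: CoatesSujatha2005, §3 (Conjecture A)] -/
theorem conjA_of_fineUnitData_tamagawa (S : Finset (HeightOneSpectrum (𝓞 K)))
    (hS : ∀ v ∉ S, ((p : ℕ) : 𝓞 K) ∉ v.asIdeal ∧ W.HasGoodReductionAt v)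
    (hrank : W.mordellWeilRank = 0) (hsha : Nat.card (AddCommGroup.primaryComponent W.sha p) = 1)
    (htam : ¬ p ∣ W.tamagawaProduct)
    (hlocp : ∀ v ∈ S, ((p : ℕ) : 𝓞 K) ∈ v.asIdeal →
      ∀ x : W.geomPrimaryTorsion p, p • x = 0 → (∀ d ∈ decomp v, d • x = x) → x = 0)
    (κ : ZpExtension K p) :
    ∃ (γ : absoluteGaloisGroup K) (D : W.FineSelmerDualData κ γ),
      Module.Finite ℤ_[p] (RestrictScalars ℤ_[p] (IwasawaAlgebra p) D.X) := by
  haveI : Finite W.toAffine.Point := W.mordellWeilRank_eq_zero_iff_finite.mp hrank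
  have hcardSel : Nat.card (W.selmerGroupPInfty p) = 1 := by
    rw [W.natCard_selmerGroupPInfty_eq_natCard_primaryComponent_sha p, hsha]
  refine FineSelmerControl.conjA_of_natCard_selmerGroupPInfty_eq_one_of_local W κ S hS hcardSel
    fun v hv ↦ ?_
  by_cases hpv : ((p : ℕ) : 𝓞 K) ∈ v.asIdeal
  · exact Or.inl (hlocp v hv hpv)
  · exact Or.inr ⟨hpv, localTowerKerPrimary_zero_eq_bot_of_not_dvd_tamagawaProduct W κ hpv htam⟩

end AnyField

/-- **(A) at `(E, p)` over `ℚ` for every cyclotomic `κ` from the Tamagawa form of the fine unit data**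
(the shape consumed by `conjA_of_modPCongruent`). [cite: CoatesSujatha2005, §3 (Conjecture A)]
[cite: GreenbergLNM1716, Prop. 3.8 (pp. 95–96)] -/
theorem conjA_rat_of_fineUnitData_tamagawa (W : WeierstrassCurve ℚ) [W.IsElliptic] {p : ℕ} [Fact p.Prime]
    (S : Finset (HeightOneSpectrum (𝓞 ℚ)))
    (hS : ∀ v ∉ S, ((p : ℕ) : 𝓞 ℚ) ∉ v.asIdeal ∧ W.HasGoodReductionAt v)
    (hrank : W.mordellWeilRank = 0) (hsha : Nat.card (AddCommGroup.primaryComponent W.sha p) = 1)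
    (htam : ¬ p ∣ W.tamagawaProduct)
    (hlocp : ∀ v ∈ S, ((p : ℕ) : 𝓞 ℚ) ∈ v.asIdeal →
      ∀ x : W.geomPrimaryTorsion p, p • x = 0 → (∀ d ∈ decomp v, d • x = x) → x = 0) :
    ∀ (κ : ZpExtension ℚ p), κ.IsCyclotomic →
      ∃ (γ : absoluteGaloisGroup ℚ) (D : W.FineSelmerDualData κ γ),
        Module.Finite ℤ_[p] (RestrictScalars ℤ_[p] (IwasawaAlgebra p) D.X) :=
  fun κ _ ↦ conjA_of_fineUnitData_tamagawa W S hS hrank hsha htam hlocp κ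

/-! ## §3 The row road with the Tamagawa socket -/

/-- **The FINE UNIT-ANCHOR road, Tamagawa form, row form.** Let `W/ℚ` be a row of the Conj-A crux of route
K9 (globally minimal, `r_an = 0`, `ClassO6 W 3`, `W[3]` irreducible) and `W′/ℚ` an elliptic curve with
`W′[3] ≅ W[3]` — ANY reduction type at `3` — such that `rank W′(ℚ) = 0`, `#Ш(W′/ℚ)[3^∞] = 1`,
`3 ∤ ∏_ℓ c_ℓ(W′)`, and, for a finite set `S` off which `W′` is good and `v ∤ 3`, `W′[3^∞]` has no non-zero
`D_v`-fixed `3`-torsion at the `v ∈ S` above `3` (`W′(ℚ₃)[3] = 0` — equivalently `W(ℚ₃)[3] = 0`, a ROW test).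
Then `ord₃ #Ш(W) ≤ ord₃ #Ш_an(W)`. [cite: GreenbergLNM1716, Prop. 3.8 (pp. 95–96) and §3 Lemma 3.3]
[cite: LimSujatha2018, §3 Prop. 3.2] [cite: Kato2004Asterisque, Thm. 14.5 (3) and Prop. 14.16 (2)] -/
theorem missingUpperBoundAt_wild_of_fineUnitAnchor_tamagawa
    (hLS : LimSujatha2018.prop32_fineSelmerDual_moduleFinite_iff_of_torsionIso)
    (hKatoA :
      Kato2004.rankZero_padicValNat_sha_add_padicValNat_tamagawa_le_of_additive_potGood_of_irreducible_of_fineSelmerDual_fg)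
    (hGZK : rank_eq_analyticRank_of_analyticRank_le_one) (hmod : hasEntireLFunction_rat)
    (W : WeierstrassCurve ℚ) [W.IsElliptic] [W.IsGloballyMinimal] [Fact (3 : ℕ).Prime]
    (hr : W.analyticRank = 0) (hO : ClassO6 W 3) (hirr : W.HasIrreducibleModPGaloisRep 3)
    (W' : WeierstrassCurve ℚ) [W'.IsElliptic] (hcong : ModPCongruent W' W 3)
    (S : Finset (HeightOneSpectrum (𝓞 ℚ)))
    (hS : ∀ v ∉ S, ((3 : ℕ) : 𝓞 ℚ) ∉ v.asIdeal ∧ W'.HasGoodReductionAt v)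
    (hrank' : W'.mordellWeilRank = 0) (hsha' : Nat.card (AddCommGroup.primaryComponent W'.sha 3) = 1)
    (htam' : ¬ 3 ∣ W'.tamagawaProduct)
    (hloc3 : ∀ v ∈ S, ((3 : ℕ) : 𝓞 ℚ) ∈ v.asIdeal →
      ∀ x : W'.geomPrimaryTorsion 3, 3 • x = 0 → (∀ d ∈ decomp v, d • x = x) → x = 0) :
    MissingUpperBoundAt W 3 :=
  WildFineSelmerSupersingularCMAnchor.missingUpperBoundAt_wild_of_conjA hKatoA hGZK hmod W hr hO hirr
    (WildFineSelmerCongruenceFact.conjA_of_modPCongruent hLS (by norm_num) hcong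
      (conjA_rat_of_fineUnitData_tamagawa W' S hS hrank' hsha' htam' hloc3))

/-- **The same with the anchor's global data in PRINTED form**: `r_an(W′) = 0`, `3 ∤ #Ш(W′/ℚ)`,
`3 ∤ ∏ c_ℓ(W′)` (exactly the three integers of the older unit-anchor roads) plus the local test at `3`.
[cite: GreenbergLNM1716, Prop. 3.8 (pp. 95–96)] [cite: LimSujatha2018, §3 Prop. 3.2] -/
theorem missingUpperBoundAt_wild_of_fineUnitAnchor_tamagawa_analytic
    (hLS : LimSujatha2018.prop32_fineSelmerDual_moduleFinite_iff_of_torsionIso)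
    (hKatoA :
      Kato2004.rankZero_padicValNat_sha_add_padicValNat_tamagawa_le_of_additive_potGood_of_irreducible_of_fineSelmerDual_fg)
    (hGZK : rank_eq_analyticRank_of_analyticRank_le_one) (hmod : hasEntireLFunction_rat)
    (W : WeierstrassCurve ℚ) [W.IsElliptic] [W.IsGloballyMinimal] [Fact (3 : ℕ).Prime]
    (hr : W.analyticRank = 0) (hO : ClassO6 W 3) (hirr : W.HasIrreducibleModPGaloisRep 3)
    (W' : WeierstrassCurve ℚ) [W'.IsElliptic] (hcong : ModPCongruent W' W 3)
    (S : Finset (HeightOneSpectrum (𝓞 ℚ)))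
    (hS : ∀ v ∉ S, ((3 : ℕ) : 𝓞 ℚ) ∉ v.asIdeal ∧ W'.HasGoodReductionAt v)
    (hr' : W'.analyticRank = 0) (hsha' : ¬ 3 ∣ Nat.card W'.sha) (htam' : ¬ 3 ∣ W'.tamagawaProduct)
    (hloc3 : ∀ v ∈ S, ((3 : ℕ) : 𝓞 ℚ) ∈ v.asIdeal →
      ∀ x : W'.geomPrimaryTorsion 3, 3 • x = 0 → (∀ d ∈ decomp v, d • x = x) → x = 0) :
    MissingUpperBoundAt W 3 := by
  obtain ⟨hmw, hfin⟩ := hGZK W' (by rw [hr']; exact zero_le_one)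
  haveI : Finite W'.sha := hfin
  have hrank' : W'.mordellWeilRank = 0 := by rw [hmw, hr']
  have h1 : Nat.card (AddCommGroup.primaryComponent W'.sha 3) = 1 := by
    rw [card_addPrimaryComponent_eq_pow 3, Nat.factorization_eq_zero_of_not_dvd hsha', pow_zero]
  exact missingUpperBoundAt_wild_of_fineUnitAnchor_tamagawa hLS hKatoA hGZK hmod W hr hO hirr W' hcong S hS
    hrank' h1 htam' hloc3

/-- **The crux body from per-row fine TAMAGAWA-anchor certificates** (class form): per ♯ row ONE congruent
elliptic `W′/ℚ` (any reduction at `3`) with a finite set `S` off which it is good and `v ∤ 3`, `rank 0`,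
`#Ш[3^∞] = 1`, `3 ∤ ∏ c_ℓ(W′)`, and no `D_v`-fixed `3`-torsion at the `v ∈ S` above `3`. Conditional on `hLS`
only; the item is NOT closed. [cite: LimSujatha2018, §3 Prop. 3.2] [cite: GreenbergLNM1716, Prop. 3.8 (pp. 95–96)] -/
theorem wildFineSelmerCoatesSujatha_of_fineTamagawaAnchorCertificates
    (hLS : LimSujatha2018.prop32_fineSelmerDual_moduleFinite_iff_of_torsionIso)
    (hcert : ∀ (W : WeierstrassCurve ℚ) [W.IsElliptic] [W.IsGloballyMinimal] [Fact (3 : ℕ).Prime],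
      W.analyticRank = 0 → ClassO6 W 3 → W.HasIrreducibleModPGaloisRep 3 →
      ¬ (∀ n : ℕ, W.HasSurjectiveModNGaloisRep (3 ^ n : ℕ)) → ¬ W.HasCM →
      ∃ (W' : WeierstrassCurve ℚ) (_ : W'.IsElliptic) (S : Finset (HeightOneSpectrum (𝓞 ℚ))),
        ModPCongruent W' W 3 ∧ (∀ v ∉ S, ((3 : ℕ) : 𝓞 ℚ) ∉ v.asIdeal ∧ W'.HasGoodReductionAt v) ∧
        W'.mordellWeilRank = 0 ∧ Nat.card (AddCommGroup.primaryComponent W'.sha 3) = 1 ∧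
        ¬ 3 ∣ W'.tamagawaProduct ∧
        (∀ v ∈ S, ((3 : ℕ) : 𝓞 ℚ) ∈ v.asIdeal →
          ∀ x : W'.geomPrimaryTorsion 3, 3 • x = 0 → (∀ d ∈ decomp v, d • x = x) → x = 0)) :
    ∀ (W : WeierstrassCurve ℚ) [W.IsElliptic] [W.IsGloballyMinimal] [Fact (3 : ℕ).Prime],
      W.analyticRank = 0 → ClassO6 W 3 → W.HasIrreducibleModPGaloisRep 3 →
      ¬ (∀ n : ℕ, W.HasSurjectiveModNGaloisRep (3 ^ n : ℕ)) → ¬ W.HasCM →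
      ∀ (κ : ZpExtension ℚ 3), κ.IsCyclotomic →
        ∃ (γ : absoluteGaloisGroup ℚ) (D : W.FineSelmerDualData κ γ),
          Module.Finite ℤ_[3] (RestrictScalars ℤ_[3] (IwasawaAlgebra 3) D.X) := by
  refine WildFineSelmerCongruenceFact.wildFineSelmerCoatesSujatha_of_mixedCertificates hLS
    fun W _ _ _ hr hO hirr hns hcm ↦ ?_
  obtain ⟨W', hW'e, S, hcong, hS, hrank', hsha', htam', hloc3⟩ := hcert W hr hO hirr hns hcm
  haveI := hW'e
  exact ⟨W', hW'e, hcong,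
    Or.inl (conjA_rat_of_fineUnitData_tamagawa W' S hS hrank' hsha' htam' hloc3)⟩

end Summit.BirchSwinnertonDyer.BirchSwinnertonDyer.Theorems.WildFineSelmerFineUnitAnchorTamagawa

end
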